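import Mathlib
import Summits.Ventures.HodgeRepro.Tier4.Line4.MainTermSplit
import Summits.Ventures.HodgeRepro.Tier4.Line4.CentreFinDomain
import Summits.Ventures.HodgeRepro.Tier4.Line4.CentreCocompact
import Summits.Ventures.HodgeRepro.Tier4.Line4.UnitLowerBound

/-!
# Tier4/Line4/MainTermSplitInvariance — C-L4-LEVELONE-LOCAL (a), way (β): the main-term integrand is `Z(k)`-invariant, so the
`p`-split factorisation holds at the GLUE'S `DZ_f`

Blind re-derivation cell `pub-hodge-repro`, Tier 4 «prove the step» (README §9–§10), LINE L4, seat t4-x2 (g5; the second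
half of `Line4/MainTermSplit` under the ≤ 400-line rule; plan-4 g6's (α)/(β) S15703, (β) of record).  Tree path
`lean/Summits/Ventures/HodgeRepro/Tier4/Line4/MainTermSplitInvariance.lean`.  Imports `Line4/MainTermSplit` (the product-domain
factorisation), L2-p2's `Line4/CentreFinDomain` (`centreFin`, `coe_coe_finTfHom`), typer-2's `Line4/CentreCocompact`
(`ofFinPart_mem_centre`).  Mathlib-level; no literature; no `def`.

* `coe_centreFin_mem_centre`, `chi_eq_chi'_of_centre`, `chi_mul_conj_chi'_eq_one` — a `Z(k)`-element is central in `G(𝔸)`,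
  `χ(z) = χ′(z′)` on the centre (`RTFData.chi_centre`), `χ(z) · conj χ′(z′) = 1` (`‖χ‖ = 1`).
* `exists_torusFin'_coe_eq_of_mem_centre` — the `T′_f`-copy of a central `T_f`-element, through L1's
  `exists_torusFin'_coe_eq` (`Line4/UnitLowerBound`, the adelic element ABSTRACTED: the inline `⟨⟨↑↑z, h₁⟩, h₂⟩` with `rfl`
  makes the KERNEL time out — it compares the two `Subtype.val` applications argument-wise and unfolds the tori).
* `innerFin_levelDC_mul_left`, `chi_mul_innerFin_levelDC_mul_left`, `chi_mul_innerFin_levelDC_centreFin_mul`,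
  **`chi_mul_innerFin_levelDC_centreFin_smul`** — the invariance `χ(z b) · I_f(z b) = χ(b) · I_f(b)` for `z ∈ Z(k)` (the
  substitution `b′ ↦ z′ b′`, `ν′_f` left-invariant, `z` through `γ₀,f`).
* **`setIntegral_chi_innerFin_levelDC_eq_mul_of_fundamentalDomain`** — the factorisation at ANY `Z(k)`-fundamental domain
  `DZ_f` (the glue's), from the EXISTENCE of a product-shaped fundamental domain `torusFinSplit⁻¹(DZ_S × DZ^{(S)})` (ZDOMAIN-EX (iv)
  in product form — an OPEN CLAIM of record, crit-2 Entry 335 (i), carried as the hypothesis `hfd'`; `DZ_S := univ` is the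
  instance of record (E1), S15757), through Mathlib's `IsFundamentalDomain.setIntegral_eq` / `integrableOn_iff`.

Nothing here says anything about the status of the Hodge conjecture for CM abelian varieties, which is NOT proved
(HC_CM is NOT proved by anyone in this repository).
-/

set_option autoImplicit false

noncomputable section

namespace Summit.Ventures.HodgeRepro.Tier4.Line4

open MeasureTheory NumberField IsDedekindDomain Summit.Ventures.HodgeRepro.Tier4
  Summit.Ventures.HodgeRepro.Tier4.Common Summit.Ventures.HodgeRepro.Tier4.Line1

open scoped NumberField ComplexConjugate NNReal

section Central

variable {k : Type} [Field k] [NumberField k] (W : PlaneData k)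

/-- An element of `Z(k)`'s image in `T_f` is a central element of `G(𝔸)` (hence lies in `T′`). -/
theorem coe_centreFin_mem_centre {z : torusFin W} (hz : z ∈ centreFin W) : ((z : torusT W) : GA W) ∈ centre W := by
  obtain ⟨z₀, hz₀, rfl⟩ := hz
  rw [coe_coe_finTfHom]
  exact ofFinPart_mem_centre W (rationalCentreT.mem_centre W hz₀)

end Central

section CentralChar

variable {k : Type} [Field k] [NumberField k] (W : PlaneData k) [MeasurableSpace (GA W)] (R : RTFData W)

/-- For a central `z ∈ T_f` and `z′ ∈ T′_f` the same adelic element, `χ(z) = χ′(z′)` (the N2 clause `RTFData.chi_centre`). -/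
theorem chi_eq_chi'_of_centre (z : torusFin W) (hz : ((z : torusT W) : GA W) ∈ centre W) (z' : torusFin' W)
    (hz' : ((z' : torusT' W) : GA W) = ((z : torusT W) : GA W)) :
    R.chi (z : torusT W) = R.chi' (z' : torusT' W) := by
  have h := R.chi_centre _ hz
  have e1 : (z : torusT W) = ⟨((z : torusT W) : GA W), centre_le_torusT W hz⟩ := Subtype.ext rfl
  have e2 : (z' : torusT' W) = ⟨((z : torusT W) : GA W), centre_le_torusT' W hz⟩ := Subtype.ext hz'
  rw [e1, e2]
  exact h

/-- `χ(z) · conj χ′(z′) = 1` for a central `z` (`‖χ‖ = 1`). -/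
theorem chi_mul_conj_chi'_eq_one (hu : ∀ a, ‖R.chi a‖ = 1) (z : torusFin W) (hz : ((z : torusT W) : GA W) ∈ centre W)
    (z' : torusFin' W) (hz' : ((z' : torusT' W) : GA W) = ((z : torusT W) : GA W)) :
    R.chi (z : torusT W) * conj (R.chi' (z' : torusT' W)) = 1 := by
  rw [← chi_eq_chi'_of_centre W R z hz z' hz', Complex.mul_conj, Complex.normSq_eq_norm_sq, hu, one_pow,
    Complex.ofReal_one]

end CentralChar

section Invariance

variable {k : Type} [Field k] [NumberField k] (W : PlaneData k) [MeasurableSpace (GA W)] [BorelSpace (GA W)]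
  (R : RTFData W) (γ₀ : GA W) (N : ℕ)

/-- **The inner integral at a central translate**: for `z ∈ T_f` central in `G(𝔸)` with `z′ ∈ T′_f` the same adelic
element, `I_f(z b) = conj χ′(z′) · I_f(b)` (substitute `b′ ↦ z′ b′`, `ν′_f` left-invariant, `z` moves through `γ₀,f`). -/
theorem innerFin_levelDC_mul_left (νf' : Measure (torusFin' W)) [νf'.IsHaarMeasure] (z : torusFin W)
    (z' : torusFin' W) (hz' : ((z' : torusT' W) : GA W) = ((z : torusT W) : GA W))
    (hcomm : ∀ g : GA W, g * ((z : torusT W) : GA W) = ((z : torusT W) : GA W) * g) (b : torusFin W) :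
    innerFin W R (levelDC W γ₀ N) γ₀ νf' (z * b) =
      conj (R.chi' (z' : torusT' W)) * innerFin W R (levelDC W γ₀ N) γ₀ νf' b := by
  haveI := secondCountable_GA W
  haveI : BorelSpace (torusT' W) := Subtype.borelSpace _
  haveI : BorelSpace (torusFin' W) := Subtype.borelSpace _
  unfold innerFin
  rw [← integral_mul_left_eq_self _ z', ← integral_const_mul]
  refine integral_congr_ae (Filter.Eventually.of_forall fun b' => ?_)
  dsimp only
  simp only [Subgroup.coe_mul, R.chi'_mul, map_mul, hz', mul_inv_rev, mul_assoc]
  rw [← mul_assoc (GA.ofFinPart W γ₀), hcomm (GA.ofFinPart W γ₀)]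
  simp only [mul_assoc, inv_mul_cancel_left]

/-- The invariance at a central `z ∈ T_f` given as an element with its `T′`-copy. -/
theorem chi_mul_innerFin_levelDC_mul_left (hu : ∀ a, ‖R.chi a‖ = 1)
    (νf' : Measure (torusFin' W)) [νf'.IsHaarMeasure] (z : torusFin W) (hz : ((z : torusT W) : GA W) ∈ centre W)
    (z' : torusFin' W) (hz' : ((z' : torusT' W) : GA W) = ((z : torusT W) : GA W)) (b : torusFin W) :
    R.chi ((z * b : torusFin W) : torusT W) * innerFin W R (levelDC W γ₀ N) γ₀ νf' (z * b) =
      R.chi (b : torusT W) * innerFin W R (levelDC W γ₀ N) γ₀ νf' b := by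
  have hcomm : ∀ g : GA W, g * ((z : torusT W) : GA W) = ((z : torusT W) : GA W) * g :=
    fun g => Subgroup.mem_center_iff.1 (centre_le_center W hz) g
  rw [innerFin_levelDC_mul_left W R γ₀ N νf' z z' hz' hcomm b, Subgroup.coe_mul, R.chi_mul]
  calc R.chi (z : torusT W) * R.chi (b : torusT W) *
        (conj (R.chi' (z' : torusT' W)) * innerFin W R (levelDC W γ₀ N) γ₀ νf' b)
      = (R.chi (z : torusT W) * conj (R.chi' (z' : torusT' W))) *
          (R.chi (b : torusT W) * innerFin W R (levelDC W γ₀ N) γ₀ νf' b) := by ring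
    _ = R.chi (b : torusT W) * innerFin W R (levelDC W γ₀ N) γ₀ νf' b := by
        rw [chi_mul_conj_chi'_eq_one W R hu z hz z' hz', one_mul]

omit [MeasurableSpace (GA W)] [BorelSpace (GA W)] in
/-- A central element of `T_f` has a copy in `T′_f` (the same adelic element). -/
theorem exists_torusFin'_coe_eq_of_mem_centre (z : torusFin W) (hz : ((z : torusT W) : GA W) ∈ centre W) :
    ∃ z' : torusFin' W, ((z' : torusT' W) : GA W) = ((z : torusT W) : GA W) :=
  exists_torusFin'_coe_eq W _ (centre_le_torusT' W hz) (coe_torusFin_mem_finitePart W z)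

/-- The invariance for `z ∈ Z(k)` written with the multiplication. -/
theorem chi_mul_innerFin_levelDC_centreFin_mul (hu : ∀ a, ‖R.chi a‖ = 1)
    (νf' : Measure (torusFin' W)) [νf'.IsHaarMeasure] (z : torusFin W) (hz : z ∈ centreFin W) (b : torusFin W) :
    R.chi ((z * b : torusFin W) : torusT W) * innerFin W R (levelDC W γ₀ N) γ₀ νf' (z * b) =
      R.chi (b : torusT W) * innerFin W R (levelDC W γ₀ N) γ₀ νf' b := by
  have hzcen : ((z : torusT W) : GA W) ∈ centre W := coe_centreFin_mem_centre W hz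
  obtain ⟨z', hz'⟩ := exists_torusFin'_coe_eq_of_mem_centre W z hzcen
  exact chi_mul_innerFin_levelDC_mul_left W R γ₀ N hu νf' z hzcen z' hz' b

/-- **THE MAIN-TERM INTEGRAND IS `Z(k)`-INVARIANT**: for `z ∈ Z(k)` (in `T_f`), `χ(z b) · I_f(z b) = χ(b) · I_f(b)`. -/
theorem chi_mul_innerFin_levelDC_centreFin_smul (hu : ∀ a, ‖R.chi a‖ = 1)
    (νf' : Measure (torusFin' W)) [νf'.IsHaarMeasure] (z : centreFin W) (b : torusFin W) :
    R.chi (((z • b : torusFin W)) : torusT W) * innerFin W R (levelDC W γ₀ N) γ₀ νf' (z • b) =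
      R.chi (b : torusT W) * innerFin W R (levelDC W γ₀ N) γ₀ νf' b := by
  rw [Subgroup.smul_def, smul_eq_mul]
  exact chi_mul_innerFin_levelDC_centreFin_mul W R γ₀ N hu νf' (z : torusFin W) z.2 b

end Invariance

section Beta

variable {k : Type} [Field k] [NumberField k] (W : PlaneData k) [MeasurableSpace (GA W)] [BorelSpace (GA W)]
  (R : RTFData W) (γ₀ : GA W)

/-- **C-L4-LEVELONE-LOCAL (a) AT THE GLUE'S `DZ_f` — way (β)**: for ANY fundamental domain `DZ_f` of `Z(k)` in `T_f` and
a PRODUCT-SHAPED fundamental domain `torusFinSplit⁻¹(DZ_S × DZ^{(S)})` (its existence = ZDOMAIN-EX (iv) in product form, an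
OPEN CLAIM of record carried as `hfd'`), the main-term finite integral over `DZ_f` equals `c c′ · I_S(n) · c₀(γ₀)` — the
integrand is `Z(k)`-invariant (`chi_mul_innerFin_levelDC_centreFin_smul`), so the two fundamental domains give the same
integral (`IsFundamentalDomain.setIntegral_eq`), and `hint` transfers (`integrableOn_iff`). -/
theorem setIntegral_chi_innerFin_levelDC_eq_mul_of_fundamentalDomain (hu : ∀ a, ‖R.chi a‖ = 1) (p n : ℕ)
    (νf : Measure (torusFin W)) [νf.IsHaarMeasure]
    (νS : Measure (torusFinAt W (placesAbove (k := k) p))) [νS.IsHaarMeasure]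
    (νA : Measure (torusFinAway W (placesAbove (k := k) p))) [νA.IsHaarMeasure]
    (c : ℝ≥0) (hc : νf = c • Measure.map (torusFinSplit W (placesAbove (k := k) p)).symm (νS.prod νA))
    (νf' : Measure (torusFin' W)) [νf'.IsHaarMeasure]
    (νS' : Measure (torusFinAt' W (placesAbove (k := k) p))) [νS'.IsHaarMeasure]
    (νA' : Measure (torusFinAway' W (placesAbove (k := k) p))) [νA'.IsHaarMeasure]
    (c' : ℝ≥0) (hc' : νf' = c' • Measure.map (torusFinSplit' W (placesAbove (k := k) p)).symm (νS'.prod νA'))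
    (DZf : Set (torusFin W)) (hfd : IsFundamentalDomain (centreFin W) DZf νf)
    (DZS : Set (torusFinAt W (placesAbove (k := k) p))) (hDZS : MeasurableSet DZS)
    (DZA : Set (torusFinAway W (placesAbove (k := k) p))) (hDZA : MeasurableSet DZA)
    (hfd' : IsFundamentalDomain (centreFin W) ((torusFinSplit W (placesAbove (k := k) p)) ⁻¹' (DZS ×ˢ DZA)) νf)
    (hint : IntegrableOn (fun b : torusFin W => R.chi (b : torusT W) * innerFin W R (levelDC W γ₀ (p ^ n)) γ₀ νf' b)
      DZf νf)
    (hB : ∀ t : torusT W, Integrable (fun b' : torusFin' W => conj (R.chi' (b' : torusT' W)) *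
      levelDC W γ₀ (p ^ n) ((GA.ofFinPart W t)⁻¹ * GA.ofFinPart W γ₀ * ((b' : torusT' W) : GA W))) νf') :
    ∫ b in DZf, R.chi (b : torusT W) * innerFin W R (levelDC W γ₀ (p ^ n)) γ₀ νf' b ∂νf =
      ((c : ℂ) * (c' : ℂ)) * localFactorAt W (placesAbove (k := k) p) R γ₀ (p ^ n) νS νS' DZS *
        awayOrbital W (placesAbove (k := k) p) R γ₀ νA νA' DZA := by
  haveI := secondCountable_GA W
  haveI : BorelSpace (torusT W) := Subtype.borelSpace _
  haveI : BorelSpace (torusFin W) := Subtype.borelSpace _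
  haveI : MeasurableMul (torusFin W) :=
    ⟨fun c => (continuous_const.mul continuous_id).measurable, fun c => (continuous_id.mul continuous_const).measurable⟩
  haveI : νf.IsMulLeftInvariant := inferInstance
  haveI : SMulInvariantMeasure (torusFin W) (torusFin W) νf := ⟨fun c _ _ => measure_preimage_mul νf c _⟩
  haveI : SMulInvariantMeasure (centreFin W) (torusFin W) νf := Subgroup.smulInvariantMeasure _
  haveI : MeasurableConstSMul (torusFin W) (torusFin W) := ⟨fun c => measurable_const_mul c⟩
  haveI : MeasurableConstSMul (centreFin W) (torusFin W) := Subgroup.instMeasurableConstSMul _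
  haveI : Countable (centreFin W) := by
    haveI : Countable (rationalCentreT W) := countable_rationalCentreT W
    have h : (centreFin W : Set (torusFin W)).Countable := by
      rw [centreFin, Subgroup.coe_map]
      exact (Set.countable_coe_iff.1 inferInstance).image _
    exact h.to_subtype
  have hinv : ∀ (z : centreFin W) (b : torusFin W),
      R.chi (((z • b : torusFin W)) : torusT W) * innerFin W R (levelDC W γ₀ (p ^ n)) γ₀ νf' (z • b) =
        R.chi (b : torusT W) * innerFin W R (levelDC W γ₀ (p ^ n)) γ₀ νf' b :=
    fun z b => chi_mul_innerFin_levelDC_centreFin_smul W R γ₀ (p ^ n) hu νf' z b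
  rw [hfd.setIntegral_eq hfd' hinv]
  exact setIntegral_chi_innerFin_levelDC_eq_mul W R γ₀ p n νf νS νA c hc νf' νS' νA' c' hc' DZS hDZS DZA hDZA
    ((hfd.integrableOn_iff hfd' hinv).1 hint) hB

end Beta

end Summit.Ventures.HodgeRepro.Tier4.Line4

end
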